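import Summits.KontsevichZagierPeriods.KontsevichZagierPeriods.Theorems.RootDecompRationalCubeDichotomyNashMultiGenP18

/-! # `RootDecompRationalCubeDichotomyNashMultiGenP19` — part 3/3 of the mechanical ≤360-line split of `src.lean`
(split by the decomp-kz census seat for landing; mathematics unchanged; part 3 continues part 2). -/

open Set MvPolynomial Filter Topology
open Literature.NumberTheory.Transcendental (IsSemialgebraicFunOn)
open Literature.ModelTheory.ExponentialFields (IsSemialgebraic isSemialgebraic_setOf_eval_pos
  isSemialgebraic_setOf_eval_ne_zero)

namespace Summit.KontsevichZagierPeriods.RootDecompRationalCubeDichotomy.Rung29430.MultiGen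
open Summit.KontsevichZagierPeriods.KontsevichZagierPeriods.Theses.RootDecompRationalCubeDichotomy
  (NashEtaleCover NashEtaleLocal PiRationalisation)
open Summit.KontsevichZagierPeriods.RootDecompRationalCubeDichotomy.Rung29430.NashEtaleLocalGlue
  (local_of_simple nashEtaleCover_of_nashEtaleLocal nashEtaleLocal_zero)
open Summit.KontsevichZagierPeriods.RootDecompRationalCubeDichotomy.Rung29430.NashEtaleLocalOne
  (analyticOnNhd_aeval_snoc)
open Summit.KontsevichZagierPeriods.RootDecompRationalCubeDichotomy.RungEtale.Etale
  (piRationalisation_of_nashEtaleCover)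

noncomputable section

section OriginOne
open Literature.NumberTheory.Transcendental Literature.ModelTheory.ExponentialFields
open Function
open scoped Polynomial.Bivariate
variable {K : Type} [CommRing K] [Algebra K ℝ]

/-- **`OriginNashExists 1`**: a `K`-semialgebraic real-analytic function of ONE variable is, at the
`K`-point `0`, a `K`-polynomial in an identified `K`-Nash system (ramified case included). -/
theorem originNashExists_one : OriginNashExists 1 := by
  intro K _ _ G U hU h0U hG han
  -- an interval `(-1/(n+1), 1/(n+1)) ∋ 0` inside `U`, with endpoints over `ℕ ⊆ K`
  obtain ⟨ε, hε, hball⟩ := Metric.isOpen_iff.mp hU 0 h0U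
  obtain ⟨n, hn⟩ := exists_nat_one_div_lt hε
  have hn1 : (0:ℝ) < (n:ℝ) + 1 := by positivity
  set b : ℝ := 1 / ((n:ℝ) + 1) with hb
  have hbpos : 0 < b := by rw [hb]; positivity
  have h0 : (0:ℝ) ∈ Set.Ioo (-b) b := ⟨by linarith, hbpos⟩
  have hDU : {t : Fin 1 → ℝ | t 0 ∈ Set.Ioo (-b) b} ⊆ U := by
    intro t ht
    apply hball
    rw [Metric.mem_ball, dist_zero_right, pi_norm_lt_iff hε]
    intro i
    rw [Subsingleton.elim i 0, Real.norm_eq_abs, abs_lt]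
    exact ⟨by linarith [ht.1], by linarith [ht.2]⟩
  -- `D` is `K`-semialgebraic
  have hD : IsSemialgebraic K {t : Fin 1 → ℝ | t 0 ∈ Set.Ioo (-b) b} := by
    have e1 : ∀ t : Fin 1 → ℝ, MvPolynomial.aeval t
        (((n + 1 : ℕ) : MvPolynomial (Fin 1) K) * MvPolynomial.X 0 + 1) =
          ((n:ℝ) + 1) * t 0 + 1 := by
      intro t
      simp
    have e2 : ∀ t : Fin 1 → ℝ, MvPolynomial.aeval t
        (1 - ((n + 1 : ℕ) : MvPolynomial (Fin 1) K) * MvPolynomial.X 0) =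
          1 - ((n:ℝ) + 1) * t 0 := by
      intro t
      simp
    have hDeq : {t : Fin 1 → ℝ | t 0 ∈ Set.Ioo (-b) b} =
        {t | 0 < MvPolynomial.aeval t
            (((n + 1 : ℕ) : MvPolynomial (Fin 1) K) * MvPolynomial.X 0 + 1)} ∩
          {t | 0 < MvPolynomial.aeval t
            (1 - ((n + 1 : ℕ) : MvPolynomial (Fin 1) K) * MvPolynomial.X 0)} := by
      ext t
      simp only [Set.mem_setOf_eq, Set.mem_inter_iff, Set.mem_Ioo, e1, e2]
      have hb' : -b = (-1) / ((n:ℝ) + 1) := by rw [hb, neg_div]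
      rw [hb', div_lt_iff₀ hn1, hb, lt_div_iff₀ hn1]
      constructor
      · rintro ⟨h1, h2⟩
        constructor <;> linarith
      · rintro ⟨h1, h2⟩
        constructor <;> linarith
    rw [hDeq]
    exact (isSemialgebraic_setOf_eval_pos _).inter (isSemialgebraic_setOf_eval_pos _)
  have hf : IsSemialgebraicFunOn K {t : Fin 1 → ℝ | t 0 ∈ Set.Ioo (-b) b}
      (fun t => G (fun _ => t 0)) :=
    (hG.mono hDU hD).congr fun t _ => by
      show G t = G (fun _ => t 0)
      congr 1
      funext i
      rw [Subsingleton.elim i 0]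
  have han' : ∀ x ∈ Set.Ioo (-b) b, AnalyticAt ℝ (fun s : ℝ => G (fun _ : Fin 1 => s)) x := by
    intro x hx
    have hmem : (fun _ : Fin 1 => x) ∈ U :=
      hDU (show (fun _ : Fin 1 => x) 0 ∈ Set.Ioo (-b) b from hx)
    have hpi : AnalyticAt ℝ (fun s : ℝ => (fun _ : Fin 1 => s)) x :=
      AnalyticAt.pi fun _ => analyticAt_id
    exact (han _ hmem).comp hpi
  obtain ⟨Q, d, ψ, hQ, hψan, hψ0, hDw⟩ := exists_relation_order h0 hf han'
  exact originPointDataExists_of_order G h0 hf han' Q d ψ hQ hψan hψ0 hDw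

/-- `OriginNash 1`. -/
theorem originNash_one : OriginNash 1 := originNash_iff_exists.mpr originNashExists_one

/-- **`SliceNash 1`** — the registered stub `stub_slice1` of skeleton `slice1` on item 33041. -/
theorem sliceNash_one : SliceNash 1 := sliceNash_of_originNash originNash_one

/-- **Item 33041 `MultiGenDefectOne` (verbatim mirror `Item33041`) HOLDS.** -/
theorem item33041_holds : Item33041 := item33041_of_sliceNash_one sliceNash_one

/-- Item 31659 `NashEtaleLocal` now needs only `SliceNash d` for `d ≥ 2` (item 33042's stub). -/
theorem nashEtaleLocal_of_sliceNash_geTwo (h₂ : ∀ d, 2 ≤ d → SliceNash d) : NashEtaleLocal :=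
  nashEtaleLocal_of_sliceNash_one_geTwo sliceNash_one h₂

/-- Item 31659 from item 33042 alone. -/
theorem nashEtaleLocal_of_item33042 (h₂ : Item33042) : NashEtaleLocal :=
  nashEtaleLocal_of_items item33041_holds h₂

/-- Crux 24903 `PiRationalisation` from item 33042 alone. -/
theorem piRationalisation_of_item33042 (h₂ : Item33042) : PiRationalisation :=
  piRationalisation_of_items item33041_holds h₂

/-- Crux 24903 `PiRationalisation` from `SliceNash d`, `d ≥ 2`. -/
theorem piRationalisation_of_sliceNash_geTwo (h₂ : ∀ d, 2 ≤ d → SliceNash d) : PiRationalisation :=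
  piRationalisation_of_items item33041_holds (item33042_of_sliceNash_geTwo h₂)

end OriginOne

/-! #### §8.7 The BORN items BY NAME (the farm snapshot now carries route-file rev ≥ 10:
`MultiGenDefectOne ↔ Item33041` and `MultiGenSpecial ↔ Item33042` are `Iff.rfl`) -/

section BornByName

open Summit.KontsevichZagierPeriods.KontsevichZagierPeriods.Theses.RootDecompRationalCubeDichotomy
  (MultiGenDefectOne MultiGenSpecial)

/-- The verbatim mirror `Item33041` IS the born item 33041 (definitional). -/
theorem item33041_iff_born : MultiGenDefectOne ↔ Item33041 := Iff.rfl

/-- The verbatim mirror `Item33042` IS the born item 33042 (definitional). -/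
theorem item33042_iff_born : MultiGenSpecial ↔ Item33042 := Iff.rfl

/-- **Born item 33041 `Theses.RootDecompRationalCubeDichotomy.MultiGenDefectOne` HOLDS**
(0 sorry, axioms `propext · Classical.choice · Quot.sound`). -/
theorem multiGenDefectOne_holds : MultiGenDefectOne := item33041_iff_born.mpr item33041_holds

/-- Item 31659 `NashEtaleLocal` from the born item 33042 `MultiGenSpecial` ALONE. -/
theorem nashEtaleLocal_of_multiGenSpecial (h : MultiGenSpecial) : NashEtaleLocal :=
  nashEtaleLocal_of_item33042 (item33042_iff_born.mp h)

/-- Item 29430 `NashEtaleCover` from the born item 33042 alone. -/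
theorem nashEtaleCover_of_multiGenSpecial (h : MultiGenSpecial) : NashEtaleCover :=
  nashEtaleCover_of_nashEtaleLocal (nashEtaleLocal_of_multiGenSpecial h)

/-- Crux 24903 `PiRationalisation` from the born item 33042 alone. -/
theorem piRationalisation_of_multiGenSpecial (h : MultiGenSpecial) : PiRationalisation :=
  piRationalisation_of_item33042 (item33042_iff_born.mp h)

/-- The born pair is now ONE item: `NashEtaleLocal ↔ MultiGenSpecial`. -/
theorem nashEtaleLocal_iff_multiGenSpecial : NashEtaleLocal ↔ MultiGenSpecial :=
  ⟨fun h => item33042_iff_born.mpr (item33042_of_nashEtaleLocal h), nashEtaleLocal_of_multiGenSpecial⟩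

end BornByName

end


/-- **Item 33041 `MultiGenDefectOne` CLOSED** — the route decl, literally, by `multiGenDefectOne_holds` (lens-2 g9 §8:
originNashExists_one → originNash_one → sliceNash_one → item33041_holds; critic decomp-kz-crit-1 g3 CLEARED 14:36:35Z with an independent probe). -/
theorem multiGenDefectOne_proof :
    Summit.KontsevichZagierPeriods.KontsevichZagierPeriods.Theses.RootDecompRationalCubeDichotomy.MultiGenDefectOne :=
  multiGenDefectOne_holds

end Summit.KontsevichZagierPeriods.RootDecompRationalCubeDichotomy.Rung29430.MultiGen
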